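import Mathlib.Algebra.MvPolynomial.CommRing
import Mathlib.Algebra.MvPolynomial.Degrees
import Literature.Computability.Complexity.Algebrization
import Literature.Computability.Complexity.PolyTimeCountable
import HarnessLib

/-!
# Multilinear extensions of Boolean functions and locality of extension oracles (CplxCore)

Trunk `CplxCore`, companion of `Algebrization.lean` (Aaronson–Wigderson's extension oracles
`ExtensionOracle`, `IsExtensionOf`, `toOracle`). This file supplies the algebra of §4.1 of
Aaronson–Wigderson and the bookkeeping about oracle access that both oracle constructions of
their §5.1 (Thm. 5.1, Thm. 5.3; files `AlgebrizationCollapse.lean`,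
`AlgebrizationSeparation.lean`) rest on:

* `Multilinear.delta a` — the multilinear indicator `δ_a = Π_{i : aᵢ = 1} xᵢ · Π_{i : aᵢ = 0} (1 - xᵢ)`
  of a Boolean point `a ∈ {0,1}ⁿ` (AW §4.1), its multidegree (`degreeOf_delta_le`: `≤ 1`) and its
  values on the cube (`eval_boolPt_delta`: `δ_a(b) = [a = b]`);
* `Multilinear.ofCube c = Σ_a c(a) · δ_a` — the multilinear polynomial with prescribed values
  `c : {0,1}ⁿ → R` on the cube (AW §4.1: "we can write `m` uniquely in the basis of `δ_z`'s"; only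
  existence is used in the tree), `R`-linear in `c` (`ofCubeₗ`), multidegree `≤ 1`
  (`degreeOf_ofCube_le`), `ofCube c (b) = c b` (`eval_boolPt_ofCube`);
* `multilinearExtension A : ExtensionOracle` — for every prime `p` and arity `n` the multilinear
  extension of the slice `A ∩ {0,1}ⁿ` over `𝔽_p`; `multilinearExtension_isExtensionOf`
  (`IsExtensionOf A 1`), whence the discharge `exists_isExtensionOf_one_holds` of the named fact
  `exists_isExtensionOf_one` of `Algebrization.lean` (and `IsAlgebrizingInclusion.exists_subset_holds`);
  locality `multilinearExtension_poly_congr` (the arity-`n` polynomial depends on `A ∩ {0,1}ⁿ` only);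
* oracle access bookkeeping: `arity_le_length_of_decode` (a query string of length `ℓ` to
  `Ã.toOracle` concerns an arity `n ≤ ℓ`), `ExtensionOracle.toOracle_congr_of_length`
  (two extension oracles agreeing at all arities `≤ ℓ` answer every query of length `≤ ℓ` alike),
  `OracleAlg.run_congr` / `queries_congr` (a run depends on the oracle only through the
  answers to the queries asked; Arora–Barak §3.4), `sliceFn_congr`, and the enumeration
  `exists_enum_isPolyTime` of the polynomial-time oracle algorithms (from
  `countable_setOf_isPolyTime`, `PolyTimeCountable.lean`): the sequence `M₁, M₂, …` against which
  Baker–Gill–Solovay-style constructions diagonalize.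

Canonical home. `OracleAlg.runAux_queriesAux_congr` / `run_congr` / `queries_congr` and
`length_eq_of_listBoolDecode` are general facts about the runner of `Oracle.lean` and the decoder
of `BoolEncodings.lean`; byte-similar copies exist downstream in the quantum files
(`Literature.Computability.QuantumComplexity.run_congr` etc. in `QuantumComplexity/OracleSeparationBQPPH.lean`,
`length_eq_of_listBoolDecode_eq_some` in `QuantumComplexity/PermanentSearchRandom.lean`), which the
complexity core cannot import; those copies are to be retired into aliases of the present ones.

## References

* S. Aaronson, A. Wigderson, *Algebrization: a new barrier in complexity theory*, STOC 2008 /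
  ACM TOCT 1 (2009), §4.1 (multilinear polynomials, the basis `δ_z`), Def. 2.2 (extension oracle),
  §5.1. [AaronsonWigderson2008]
* L. Babai, L. Fortnow, C. Lund, *Non-deterministic exponential time has two-prover interactive
  protocols*, Comput. Complexity 1 (1991), §3 (multilinear / low-degree extensions).
* S. Arora, B. Barak, *Computational Complexity: A Modern Approach*, CUP 2009, §3.4 (oracle
  machines), §8.3.1 area (multilinear extensions in arithmetization).
-/

namespace Literature.Computability.Complexity

open _root_.Computability MvPolynomial

namespace Multilinear

variable {R : Type*} [CommRing R] {n : ℕ}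

/-! ### Boolean points and the indicator basis `δ_a` -/

/-- A Boolean point `b ∈ {0,1}ⁿ` read in the ring `R` (`true ↦ 1`, `false ↦ 0`), the
evaluation point used in `ExtensionOracle.IsExtensionOf`. [cite: AaronsonWigderson2008, Def. 2.2] -/
def boolPt (b : Fin n → Bool) : Fin n → R := fun i => if b i then 1 else 0

/-- `boolPt b i = 1` if `b i`, else `0` (definitional). [folklore] -/
@[simp] theorem boolPt_apply (b : Fin n → Bool) (i : Fin n) :
    (boolPt b i : R) = if b i then 1 else 0 := rfl

/-- The multilinear indicator polynomial of the Boolean point `a`: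
`δ_a = Π_{i : aᵢ = 1} xᵢ · Π_{i : aᵢ = 0} (1 - xᵢ)`, "the unique multilinear polynomial that is `1`
at `a` and `0` elsewhere on the Boolean cube". [cite: AaronsonWigderson2008, §4.1] -/
noncomputable def delta (a : Fin n → Bool) : MvPolynomial (Fin n) R :=
  ∏ i, if a i then X i else 1 - X i

/-- Each factor of `δ_a` has degree `≤ 1` in every variable (`xᵢ` or `1 - xᵢ`). [cite: AaronsonWigderson2008, §4.1] -/
theorem degreeOf_factor_le (a : Fin n → Bool) (i j : Fin n) :
    (if a i then (X i : MvPolynomial (Fin n) R) else 1 - X i).degreeOf j ≤ if j = i then 1 else 0 := by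
  rcases subsingleton_or_nontrivial R with hR | hR
  · rw [Subsingleton.elim (if a i then (X i : MvPolynomial (Fin n) R) else 1 - X i) 0, degreeOf_zero]
    exact Nat.zero_le _
  have hX : (X i : MvPolynomial (Fin n) R).degreeOf j = if j = i then 1 else 0 := degreeOf_X j i
  cases h : a i
  · simp only [Bool.false_eq_true, if_false]
    refine (degreeOf_sub_le j _ _).trans ?_
    rw [degreeOf_one, hX]
    simp
  · simp only [if_true]
    rw [hX]

/-- `δ_a` is multilinear: degree `≤ 1` in each variable. [cite: AaronsonWigderson2008, §4.1] -/
theorem degreeOf_delta_le (a : Fin n → Bool) (j : Fin n) :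
    (delta a : MvPolynomial (Fin n) R).degreeOf j ≤ 1 := by
  unfold delta
  refine (degreeOf_prod_le j _ _).trans ?_
  calc ∑ i, (if a i then (X i : MvPolynomial (Fin n) R) else 1 - X i).degreeOf j
      ≤ ∑ i : Fin n, (if j = i then 1 else 0 : ℕ) := Finset.sum_le_sum fun i _ => degreeOf_factor_le a i j
    _ = 1 := by simp [Finset.sum_ite_eq]

/-- On the cube, `δ_a(b) = [a = b]`. [cite: AaronsonWigderson2008, §4.1] -/
theorem eval_boolPt_delta (a b : Fin n → Bool) :
    eval (boolPt b) (delta a : MvPolynomial (Fin n) R) = if a = b then 1 else 0 := by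
  unfold delta
  rw [eval_prod]
  have hfac : ∀ i, eval (boolPt b) (if a i then (X i : MvPolynomial (Fin n) R) else 1 - X i) =
      if a i = b i then 1 else 0 := by
    intro i
    cases ha : a i <;> cases hb : b i <;> simp [hb, boolPt]
  simp_rw [hfac]
  split_ifs with hab
  · subst hab
    simp
  · obtain ⟨i, hi⟩ : ∃ i, a i ≠ b i := by
      by_contra h
      push Not at h
      exact hab (funext h)
    exact Finset.prod_eq_zero (Finset.mem_univ i) (if_neg hi)

/-! ### Multilinear polynomials with prescribed values on the cube -/

/-- `ofCube c = Σ_{a ∈ {0,1}ⁿ} c(a) · δ_a`: the multilinear polynomial taking the value `c a` at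
the Boolean point `a` (AW §4.1, `m(x) = Σ_z m_z δ_z(x)`). [cite: AaronsonWigderson2008, §4.1] -/
noncomputable def ofCube (c : (Fin n → Bool) → R) : MvPolynomial (Fin n) R :=
  ∑ a, C (c a) * delta a

/-- `ofCube` is multilinear: degree `≤ 1` in each variable. [cite: AaronsonWigderson2008, §4.1] -/
theorem degreeOf_ofCube_le (c : (Fin n → Bool) → R) (j : Fin n) : (ofCube c).degreeOf j ≤ 1 := by
  unfold ofCube
  refine (degreeOf_sum_le j _ _).trans (Finset.sup_le fun a _ => ?_)
  exact (degreeOf_C_mul_le _ _ _).trans (degreeOf_delta_le a j)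

/-- On the cube, `ofCube c` takes the prescribed values: `(ofCube c)(b) = c b` ("for any Boolean
point `z`, the value `m(z)` is simply the coefficient `m_z`"). [cite: AaronsonWigderson2008, §4.1] -/
theorem eval_boolPt_ofCube (c : (Fin n → Bool) → R) (b : Fin n → Bool) :
    eval (boolPt b) (ofCube c) = c b := by
  unfold ofCube
  rw [map_sum]
  simp_rw [map_mul, eval_C, eval_boolPt_delta]
  simp [Finset.sum_ite_eq']

/-- `ofCube` as an `R`-linear map from value tables `{0,1}ⁿ → R` to polynomials. [cite: AaronsonWigderson2008, §4.1] -/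
noncomputable def ofCubeₗ : ((Fin n → Bool) → R) →ₗ[R] MvPolynomial (Fin n) R where
  toFun := ofCube
  map_add' c c' := by
    simp only [ofCube, Pi.add_apply, map_add, add_mul]
    exact Finset.sum_add_distrib
  map_smul' r c := by
    simp only [ofCube, Pi.smul_apply, smul_eq_mul, RingHom.id_apply, Finset.smul_sum]
    refine Finset.sum_congr rfl fun a _ => ?_
    rw [map_mul, mul_assoc, smul_eq_C_mul]

/-- `ofCubeₗ c = ofCube c` (definitional). [folklore] -/
@[simp] theorem ofCubeₗ_apply (c : (Fin n → Bool) → R) : ofCubeₗ c = ofCube c := rfl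

/-- `ofCube 0 = 0`. [folklore] -/
@[simp] theorem ofCube_zero : ofCube (0 : (Fin n → Bool) → R) = 0 :=
  (ofCubeₗ (R := R) (n := n)).map_zero

end Multilinear

/-! ### The multilinear extension oracle of a language -/

/-- **The multilinear extension of a language** `A ⊆ {0,1}*`: for every prime `p` and arity `n`,
the multilinear polynomial over `𝔽_p` agreeing with `A ∩ {0,1}ⁿ` on the cube,
`Σ_{a ∈ A ∩ {0,1}ⁿ} δ_a` (AW Thm. 5.1: "let `Ã` be the unique multilinear extension of `A`";
Babai–Fortnow–Lund). [cite: AaronsonWigderson2008, §4.1 and Thm. 5.1] -/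
noncomputable def multilinearExtension (A : Language Bool) : ExtensionOracle where
  poly p n := Multilinear.ofCube fun a => if A.sliceFn n a then (1 : ZMod p) else 0

/-- The multilinear extension of `A` is an extension of `A` of multidegree `≤ 1`. [cite: AaronsonWigderson2008, §4.1] -/
theorem multilinearExtension_isExtensionOf (A : Language Bool) :
    (multilinearExtension A).IsExtensionOf A 1 := by
  intro p n
  refine ⟨fun i => Multilinear.degreeOf_ofCube_le _ i, fun x => ?_⟩
  exact Multilinear.eval_boolPt_ofCube (R := ZMod p) _ x

/-- **Locality**: the arity-`n` component of the multilinear extension depends only on the slice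
`A ∩ {0,1}ⁿ`. [cite: AaronsonWigderson2008, §4.1] -/
theorem multilinearExtension_poly_congr {A B : Language Bool} {n : ℕ} (h : A.sliceFn n = B.sliceFn n)
    (p : Nat.Primes) : (multilinearExtension A).poly p n = (multilinearExtension B).poly p n := by
  simp [multilinearExtension, h]

/-- Discharge of the named fact `exists_isExtensionOf_one` (`Algebrization.lean`): every language
has a multilinear extension over every prime field. [cite: AaronsonWigderson2008, §4.1] -/
theorem exists_isExtensionOf_one_holds : exists_isExtensionOf_one :=
  fun A => ⟨multilinearExtension A, multilinearExtension_isExtensionOf A⟩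

/-- Discharge of the named fact `IsAlgebrizingInclusion.exists_subset` (`Algebrization.lean`): an
algebrizing inclusion yields, for every `A`, a multilinear `Ã` with `C^A ⊆ D^Ã`. [cite: AaronsonWigderson2008, §1.2 and §4.1] -/
theorem IsAlgebrizingInclusion.exists_subset_holds : IsAlgebrizingInclusion.exists_subset :=
  fun h A => ⟨multilinearExtension A, multilinearExtension_isExtensionOf A,
    h A (multilinearExtension A) 1 (multilinearExtension_isExtensionOf A)⟩

/-! ### Oracle access bookkeeping: arities of queries, agreement of oracles, locality of runs -/

/-- Two languages with the same strings of length `n` have the same slice `· ∩ {0,1}ⁿ`. [folklore] -/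
theorem sliceFn_congr {A B : Language Bool} {n : ℕ}
    (h : ∀ w : List Bool, w.length = n → (w ∈ A ↔ w ∈ B)) : A.sliceFn n = B.sliceFn n := by
  funext x
  have hx : (List.ofFn x ∈ (A : Set (List Bool))) ↔ (List.ofFn x ∈ (B : Set (List Bool))) :=
    h (List.ofFn x) List.length_ofFn
  show Set.boolIndicator A (List.ofFn x) = Set.boolIndicator B (List.ofFn x)
  by_cases hB : List.ofFn x ∈ (B : Set (List Bool))
  · rw [(Set.mem_iff_boolIndicator _ _).1 hB, (Set.mem_iff_boolIndicator _ _).1 (hx.2 hB)]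
  · rw [(Set.notMem_iff_boolIndicator _ _).1 hB,
      (Set.notMem_iff_boolIndicator _ _).1 fun hA => hB (hx.1 hA)]

/-- **The enumeration `M₁, M₂, …` of polynomial-time oracle algorithms**: some sequence
`e : ℕ → OracleAlg Bool` contains every oracle algorithm with a polynomial-time step function
(`countable_setOf_isPolyTime`). [cite: BakerGillSolovay1975, §1] [cite: AroraBarak2009, §1.4] -/
theorem exists_enum_isPolyTime :
    ∃ e : ℕ → OracleAlg Bool, ∀ M : OracleAlg Bool, M.IsPolyTime encodingBoolBool → M ∈ Set.range e := by
  haveI : Nonempty (OracleAlg Bool) := ⟨⟨fun _ _ => Sum.inr true⟩⟩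
  obtain ⟨e, he⟩ := (Set.countable_iff_exists_subset_range).1 (countable_setOf_isPolyTime encodingBoolBool)
  exact ⟨e, fun M hM => he hM⟩

/-- The fuel-indexed list decoder returns lists of exactly the requested length. [folklore] -/
theorem length_eq_of_listBoolDecode {α : Type} (e : Encoding α Bool) :
    ∀ (k : ℕ) (w : List Bool) (l : List α), listBoolDecode e k w = some l → l.length = k
  | 0, w, l, h => by
    simp only [listBoolDecode, Option.some.injEq] at h
    subst h
    rfl
  | k + 1, w, l, h => by
    simp only [listBoolDecode, Option.pure_def, Option.bind_eq_bind, Option.bind_eq_some_iff,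
      Option.some.injEq] at h
    obtain ⟨a, -, l', hl', rfl⟩ := h
    simp [length_eq_of_listBoolDecode e k _ l' hl']

/-- **A query of length `ℓ` concerns an arity `n ≤ ℓ`**: if the query string `y` decodes
(`encodingExtQuery`) to `(p, n, x)` with `x ∈ ℕⁿ`, then `n ≤ |y|` — the vector `x` is a list of
`n` encoded naturals whose unary length field alone has `n` symbols. This is what makes oracle
constructions by string length (Baker–Gill–Solovay style stages) compatible with extension
oracles. [cite: AaronsonWigderson2008, Def. 2.2 and §5.1] -/
theorem arity_le_length_of_decode {y : List Bool} {p n : ℕ} {x : Fin n → ℕ}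
    (h : encodingExtQuery.decode y = some ⟨p, n, x⟩) : n ≤ y.length := by
  -- unfold the two `sigmaBool` layers and the vector decoder
  have h1 : sigmaBoolDecode (fun _ => Encoding.sigmaBool encodingNatVec) (decodeNat (boolUnpair y).1)
      (boolUnpair y).2 = some ⟨p, n, x⟩ := h
  simp only [sigmaBoolDecode, Option.map_eq_some_iff] at h1
  obtain ⟨⟨n', x'⟩, h2, h3⟩ := h1
  simp only [Sigma.mk.injEq] at h3
  obtain ⟨rfl, h3⟩ := h3
  have h3' : (⟨n', x'⟩ : Σ n, Fin n → ℕ) = ⟨n, x⟩ := eq_of_heq h3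
  rw [h3'] at h2
  set v := (boolUnpair y).2 with hv
  have h4 : sigmaBoolDecode encodingNatVec (decodeNat (boolUnpair v).1) (boolUnpair v).2 = some ⟨n, x⟩ := h2
  simp only [sigmaBoolDecode, Option.map_eq_some_iff] at h4
  obtain ⟨x'', h5, h6⟩ := h4
  simp only [Sigma.mk.injEq] at h6
  obtain ⟨rfl, -⟩ := h6
  set w := (boolUnpair v).2 with hw
  -- the vector decoder: a list of length exactly `n`, decoded with fuel `|fst (boolUnpair w)|`
  have h7 : ((encodingListNatBool.decode w).bind fun l =>
      if h : l.length = decodeNat (boolUnpair v).1 then some (fun i => l.get (i.cast h.symm)) else none) =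
      some x'' := h5
  simp only [Option.bind_eq_some_iff] at h7
  obtain ⟨l, hl, hl'⟩ := h7
  have hlen : l.length = decodeNat (boolUnpair v).1 := by
    by_contra hne
    simp [hne] at hl'
  have hl2 : listBoolDecode encodingNatBool (unaryDecodeNat (boolUnpair w).1) (boolUnpair w).2 = some l := hl
  have hlen' := length_eq_of_listBoolDecode _ _ _ _ hl2
  have hu : unaryDecodeNat (boolUnpair w).1 = ((boolUnpair w).1).length := rfl
  have hwv : w.length ≤ v.length := by
    have := length_boolUnpair_parts_le v; rw [← hw] at this; omega
  have hvy : v.length ≤ y.length := by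
    have := length_boolUnpair_parts_le y; rw [← hv] at this; omega
  have hfw : ((boolUnpair w).1).length ≤ w.length := by
    have := length_boolUnpair_parts_le w; omega
  rw [← hlen, hlen', hu]
  omega

namespace ExtensionOracle

/-- **An extension oracle is seen only through the values at the queried points**: if, for the
point `(p, n, x)` the query `y` decodes to, the polynomials of `Ã₁` and `Ã₂` at `(p, n)` take the
same value at `x mod p`, then both oracles answer `y` identically. [cite: AaronsonWigderson2008, Def. 2.2] -/
theorem toOracle_congr_of_eval {Ã₁ Ã₂ : ExtensionOracle} {y : List Bool}
    (h : ∀ (p : Nat.Primes) (n : ℕ) (x : Fin n → ℕ), encodingExtQuery.decode y = some ⟨(p : ℕ), n, x⟩ →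
      MvPolynomial.eval (fun i => (x i : ZMod p)) (Ã₁.poly p n) =
        MvPolynomial.eval (fun i => (x i : ZMod p)) (Ã₂.poly p n)) :
    Ã₁.toOracle y = Ã₂.toOracle y := by
  unfold toOracle
  cases hd : encodingExtQuery.decode y with
  | none => rfl
  | some q =>
    obtain ⟨p, n, x⟩ := q
    simp only [answer]
    split_ifs with hp
    · rw [h ⟨p, hp⟩ n x hd]
    · rfl

/-- **Agreement below a length**: if two extension oracles have the same polynomials at all
arities `n ≤ ℓ` (all primes), they answer every query string of length `≤ ℓ` identically.
[cite: AaronsonWigderson2008, Def. 2.2 and §5.1] -/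
theorem toOracle_congr_of_length {Ã₁ Ã₂ : ExtensionOracle} {ℓ : ℕ}
    (h : ∀ (p : Nat.Primes) (n : ℕ), n ≤ ℓ → Ã₁.poly p n = Ã₂.poly p n) {y : List Bool}
    (hy : y.length ≤ ℓ) : Ã₁.toOracle y = Ã₂.toOracle y :=
  toOracle_congr_of_eval fun p n _ hd => by rw [h p n ((arity_le_length_of_decode hd).trans hy)]

end ExtensionOracle

namespace OracleAlg

variable {β : Type}

/-- Two oracles that agree on every query asked during a run produce the same run and the same
transcript (induction on the fuel; the same lemma, for the same runner, as
`Literature.Computability.QuantumComplexity.runAux_queriesAux_congr`, restated here to keep the import graph of the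
complexity core free of the quantum files). [cite: AroraBarak2009, §3.4] -/
theorem runAux_queriesAux_congr (M : OracleAlg β) {O O' : Oracle} (x : List Bool) :
    ∀ (k : ℕ) (ans : List (List Bool)), (∀ y ∈ M.queriesAux O x k ans, O' y = O y) →
      M.runAux O' x k ans = M.runAux O x k ans ∧
        M.queriesAux O' x k ans = M.queriesAux O x k ans
  | 0, _, _ => ⟨rfl, rfl⟩
  | k + 1, ans, h => by
    unfold OracleAlg.runAux OracleAlg.queriesAux
    unfold OracleAlg.queriesAux at h
    cases hs : M.step x ans with
    | inr b => simp
    | inl qy =>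
      simp only [hs, List.mem_cons, forall_eq_or_imp] at h
      obtain ⟨hq, hrest⟩ := h
      simp only [hq]
      obtain ⟨h1, h2⟩ := runAux_queriesAux_congr M x k (ans ++ [O qy]) hrest
      exact ⟨h1, by rw [h2]⟩

/-- **Runs are determined by the answers to the queries asked.** [cite: AroraBarak2009, §3.4] -/
theorem run_congr (M : OracleAlg β) {O O' : Oracle} {k : ℕ} {x : List Bool}
    (h : ∀ y ∈ M.queries O k x, O' y = O y) : M.run O' k x = M.run O k x :=
  (runAux_queriesAux_congr M x k [] h).1

/-- Transcripts are determined by the answers to the queries asked. [cite: AroraBarak2009, §3.4] -/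
theorem queries_congr (M : OracleAlg β) {O O' : Oracle} {k : ℕ} {x : List Bool}
    (h : ∀ y ∈ M.queries O k x, O' y = O y) : M.queries O' k x = M.queries O k x :=
  (runAux_queriesAux_congr M x k [] h).2

end OracleAlg

end Literature.Computability.Complexity
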